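import Mathlib
import Summits.QuantumFields.YangMills.Theorems.RationalShortRootRigidityLagrangeAlternation

/-!
# `RationalShortRootRigidity` — Step 4 (`stub_alternation`) assembly, part I: the alternation core

Part of the ASSEMBLY of Step 4 of the paper proof of crux `stmt-QuantumFields-23124`
(`F4SubCurvatureDoor.RationalShortRootRigidity`, LINE g15-A of planner ym-idea-3; birth skeleton
HOME l15/RationalShortRootRigidity-birth.lean, stub `stub_alternation`; plan HOME l15/STUB-PLAN-Alternation.md §2).

We work in the «shell picture»: the even numerator `N₀(p) = Ñ(p₀², q)` is rewritten as `N₀(p) = E(p², q)` with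
`E ∈ ℝ[X, q₁, q₂, q₃]` (variable `0 = X = p²`, variables `1..3 = q`).  In these coordinates the shell values of the plan,
`n_j(q) = Ñ(−μ_j − |q|², q)`, are simply `E(−μ_j, q)`, and the scaling `q ↦ λ q` at FIXED shell `X = −μ_j` separates the
`q`-homogeneous components `E_b` of `E` (weights `(0,1,1,1)`):  `E(−μ_j, λq̂) = Σ_b λ^b E_b(−μ_j, q̂)`.

**Theorem** (`qComponent_eq_zero_of_alternation`).  Let `μ₀ < ⋯ < μ_{k−1}` (simple real shells), `c ≠ 0`, and let
`E` satisfy the BUDGET «every monomial `X^a q^m` of `E` has `2a + |m| ≤ 2k + 2`» and the SHELL SIGNS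
«`0 ≤ c·(−1)^j·E(−μ_j, q)` for every real `q ≠ 0` and every `j`».  Then `E_b = 0` for every `b ≥ 5`.

Proof (plan §2, Chevalley-free).  Let `b* ≥ 5` be the largest `b` with `E_b ≠ 0`.  For `q̂ ≠ 0` the fibre polynomial
`P(X) := E_{b*}(X, q̂)` has `X`-degree `≤ k − 2` (budget: `2a ≤ 2k + 2 − b* ≤ 2k − 3`); the shell sign at `q = λq̂` is a
polynomial inequality in `λ` whose top coefficient is `c(−1)^j P(−μ_j)`, hence `≥ 0` (`top_coeff_nonneg`); so the values of
`P` weakly alternate over the `k` nodes `−μ_{k−1} < ⋯ < −μ₀` and `lagrangeAlternation` (p662301) gives `P = 0`.  Thus `E_{b*}`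
vanishes at every `(X, q̂)` with `q̂ ≠ 0`, and at `q̂ = 0` by `q`-homogeneity of positive degree; so `E_{b*} = 0`, contradiction.

Mathlib + the tree lemma `lagrangeAlternation`; THEOREMS ONLY (no definitions: the weight `(0,1,1,1)` and the fibre polynomial
`Polynomial.map (eval q̂) (finSuccEquiv ℝ 3 ·)` are written inline); no named facts; no `sorry`; default heartbeats.  Nothing about
the crux 23124, the route's rung or the Yang–Mills mass gap is proved here.  Free-hands width seat `ym-line-sfw-p2-w4` g18
(announced on the owner's bus 2026-08-28T21:3xZ), `--supports stmt-QuantumFields-23124`.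
-/

set_option autoImplicit false

namespace Summit.QuantumFields.YangMills.Theorems.RationalShortRootRigidity.Alternation

open scoped BigOperators Polynomial

/-! ### 1. Top coefficient of a polynomial expression that is non-negative for all large arguments -/

/-- If `Σ_{b ≤ B} a_b t^b ≥ 0` for every real `t ≥ 1`, then the top coefficient `a_B` is `≥ 0`. [folklore] -/
theorem top_coeff_nonneg (B : ℕ) (a : ℕ → ℝ)
    (h : ∀ t : ℝ, 1 ≤ t → 0 ≤ ∑ b ∈ Finset.range (B + 1), a b * t ^ b) : 0 ≤ a B := by
  by_contra hneg
  push Not at hneg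
  have haB : 0 < -a B := by linarith
  set S : ℝ := ∑ b ∈ Finset.range B, |a b| with hS
  have hS0 : 0 ≤ S := Finset.sum_nonneg fun b _ => abs_nonneg _
  set t : ℝ := S / (-a B) + 2 with ht
  have hdiv : 0 ≤ S / (-a B) := div_nonneg hS0 haB.le
  have ht1 : 1 ≤ t := by linarith
  have ht0 : 0 < t := by linarith
  have key := h t ht1
  rw [Finset.sum_range_succ] at key
  cases B with
  | zero =>
    simp only [Finset.range_zero, Finset.sum_empty, zero_add, pow_zero, mul_one] at key
    linarith
  | succ B =>
    have hlow : ∑ b ∈ Finset.range (B + 1), a b * t ^ b ≤ S * t ^ B := by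
      rw [hS, Finset.sum_mul]
      refine Finset.sum_le_sum fun b hb => ?_
      have hb' : b ≤ B := by
        have := Finset.mem_range.1 hb
        omega
      calc a b * t ^ b ≤ |a b| * t ^ b :=
            mul_le_mul_of_nonneg_right (le_abs_self _) (pow_nonneg ht0.le _)
        _ ≤ |a b| * t ^ B := mul_le_mul_of_nonneg_left (pow_le_pow_right₀ ht1 hb') (abs_nonneg _)
    have hne : a (B + 1) ≠ 0 := ne_of_lt hneg
    have hprod : a (B + 1) * (S / (-a (B + 1))) = -S := by
      field_simp
    have htop : S + a (B + 1) * t = 2 * a (B + 1) := by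
      rw [ht, mul_add, hprod]
      ring
    have hBpos : 0 < t ^ B := pow_pos ht0 _
    have : ∑ b ∈ Finset.range (B + 1), a b * t ^ b + a (B + 1) * t ^ (B + 1) ≤ t ^ B * (S + a (B + 1) * t) := by
      rw [pow_succ]
      nlinarith
    rw [htop] at this
    nlinarith

/-! ### 2. `q`-scaling of the `q`-weighted-homogeneous components -/

/-- The weight `(0,1,1,1)` of a monomial `X^{m₀} q^{m'}` is the `q`-degree `|m'|`. [folklore] -/
theorem weight_q (m : Fin 4 →₀ ℕ) :
    Finsupp.weight (fun i : Fin 4 => if i = 0 then (0 : ℕ) else 1) m = ∑ i : Fin 3, m (Fin.succ i) := by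
  rw [Finsupp.weight_apply, Finsupp.sum_fintype _ _ (fun i => by simp)]
  rw [Fin.sum_univ_succ]
  simp only [↓reduceIte, smul_eq_mul, mul_zero, zero_add, Fin.succ_ne_zero, mul_one]

/-- `q`-scaling: a polynomial `E_b(X, q)` that is `q`-homogeneous of degree `b` (weights `(0,1,1,1)`) satisfies
`E_b(X, t·q) = t^b · E_b(X, q)`. [folklore] -/
theorem eval_cons_smul_of_isWeightedHomogeneous (φ : MvPolynomial (Fin 4) ℝ) (b : ℕ)
    (hφ : MvPolynomial.IsWeightedHomogeneous (fun i : Fin 4 => if i = 0 then (0 : ℕ) else 1) φ b)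
    (x : ℝ) (q : Fin 3 → ℝ) (t : ℝ) :
    MvPolynomial.eval (Fin.cons x (t • q) : Fin 4 → ℝ) φ = t ^ b * MvPolynomial.eval (Fin.cons x q : Fin 4 → ℝ) φ := by
  rw [MvPolynomial.eval_eq', MvPolynomial.eval_eq', Finset.mul_sum]
  refine Finset.sum_congr rfl fun d hd => ?_
  have hw : ∑ i : Fin 3, d (Fin.succ i) = b := by
    rw [← weight_q]
    exact hφ (MvPolynomial.mem_support_iff.1 hd)
  rw [Fin.prod_univ_succ (f := fun i => (Fin.cons x (t • q) : Fin 4 → ℝ) i ^ d i),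
    Fin.prod_univ_succ (f := fun i => (Fin.cons x q : Fin 4 → ℝ) i ^ d i)]
  simp only [Fin.cons_zero, Fin.cons_succ, Pi.smul_apply, smul_eq_mul, mul_pow]
  rw [Finset.prod_mul_distrib, Finset.prod_pow_eq_pow_sum, hw]
  ring

/-! ### 3. The fibre polynomial `X ↦ E(X, q)` -/

/-- Evaluation of the fibre polynomial `Polynomial.map (eval q) (finSuccEquiv ℝ 3 φ)` at `x` is `φ(x, q)`. [folklore] -/
theorem eval_fibre (φ : MvPolynomial (Fin 4) ℝ) (q : Fin 3 → ℝ) (x : ℝ) :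
    (Polynomial.map (MvPolynomial.eval q) (MvPolynomial.finSuccEquiv ℝ 3 φ)).eval x =
      MvPolynomial.eval (Fin.cons x q : Fin 4 → ℝ) φ :=
  (MvPolynomial.eval_eq_eval_mv_eval' q x φ).symm

/-! ### 4. The alternation core -/

/-- **Alternation core** (Step 4 of the paper proof of 23124, plan §2, Chevalley-free).  Simple real shells
`μ₀ < ⋯ < μ_{k−1}`, `c ≠ 0`; `E(X, q)` with the budget `2·deg_X + deg_q ≤ 2k + 2` monomialwise and the shell signs
`0 ≤ c(−1)^j E(−μ_j, q)` (`q ≠ 0`).  Then every `q`-homogeneous component of `E` of `q`-degree `≥ 5` vanishes. [folklore] -/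
theorem qComponent_eq_zero_of_alternation (k : ℕ) (μ : Fin k → ℝ) (hμ : StrictMono μ) (c : ℝ) (hc : c ≠ 0)
    (E : MvPolynomial (Fin 4) ℝ)
    (hbudget : ∀ m ∈ E.support, 2 * m 0 + ∑ i : Fin 3, m (Fin.succ i) ≤ 2 * k + 2)
    (hALT : ∀ q : Fin 3 → ℝ, q ≠ 0 → ∀ j : Fin k,
      0 ≤ c * (-1) ^ (j : ℕ) * MvPolynomial.eval (Fin.cons (-(μ j)) q : Fin 4 → ℝ) E) :
    ∀ b : ℕ, 5 ≤ b →
      MvPolynomial.weightedHomogeneousComponent (fun i : Fin 4 => if i = 0 then (0 : ℕ) else 1) b E = 0 := by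
  classical
  set w : Fin 4 → ℕ := fun i => if i = 0 then (0 : ℕ) else 1 with hwdef
  by_contra hcon
  push Not at hcon
  -- components above the total degree vanish
  have hzero : ∀ b : ℕ, E.totalDegree < b → MvPolynomial.weightedHomogeneousComponent w b E = 0 := by
    intro b hb
    apply MvPolynomial.weightedHomogeneousComponent_eq_zero'
    intro d hd
    have h1 : Finsupp.weight w d ≤ E.totalDegree := by
      refine le_trans ?_ (MvPolynomial.le_totalDegree hd)
      rw [hwdef, weight_q, Finsupp.sum_fintype _ _ (fun _ => rfl), Fin.sum_univ_succ]
      exact Nat.le_add_left _ _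
    exact Nat.ne_of_lt (lt_of_le_of_lt h1 hb)
  -- the largest bad `q`-degree `bs ≥ 5`
  set bad : Finset ℕ := (Finset.range (E.totalDegree + 1)).filter
    (fun b => 5 ≤ b ∧ MvPolynomial.weightedHomogeneousComponent w b E ≠ 0) with hbad
  have hne : bad.Nonempty := by
    obtain ⟨b, hb5, hb⟩ := hcon
    refine ⟨b, Finset.mem_filter.2 ⟨Finset.mem_range.2 ?_, hb5, hb⟩⟩
    by_contra hlt
    exact hb (hzero b (by omega))
  set bs : ℕ := bad.max' hne with hbsdef
  have hbs : 5 ≤ bs ∧ MvPolynomial.weightedHomogeneousComponent w bs E ≠ 0 :=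
    (Finset.mem_filter.1 (Finset.max'_mem bad hne)).2
  have habove : ∀ b : ℕ, bs < b → MvPolynomial.weightedHomogeneousComponent w b E = 0 := by
    intro b hb
    by_contra h
    by_cases hT : E.totalDegree < b
    · exact h (hzero b hT)
    · have hmem : b ∈ bad := Finset.mem_filter.2 ⟨Finset.mem_range.2 (by omega), by omega, h⟩
      have := Finset.le_max' bad b hmem
      rw [← hbsdef] at this
      omega
  -- `E` is the sum of its components of `q`-degree `≤ bs`
  have hdecomp : E = ∑ b ∈ Finset.range (bs + 1), MvPolynomial.weightedHomogeneousComponent w b E := by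
    conv_lhs => rw [← MvPolynomial.sum_weightedHomogeneousComponent w E]
    refine finsum_eq_sum_of_support_subset _ fun b hb => ?_
    rw [Function.mem_support] at hb
    rw [Finset.coe_range, Set.mem_Iio]
    by_contra hlt
    exact hb (habove b (by omega))
  -- the top component vanishes on every fibre `q̂ ≠ 0`
  have hfib0 : ∀ qh : Fin 3 → ℝ, qh ≠ 0 →
      Polynomial.map (MvPolynomial.eval qh)
        (MvPolynomial.finSuccEquiv ℝ 3 (MvPolynomial.weightedHomogeneousComponent w bs E)) = 0 := by
    intro qh hqh
    set P : ℕ → ℝ[X] := fun b => Polynomial.map (MvPolynomial.eval qh)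
      (MvPolynomial.finSuccEquiv ℝ 3 (MvPolynomial.weightedHomogeneousComponent w b E)) with hPdef
    -- the scaling identity at fixed `X = x`
    have hscale : ∀ x t : ℝ, MvPolynomial.eval (Fin.cons x (t • qh) : Fin 4 → ℝ) E =
        ∑ b ∈ Finset.range (bs + 1), (P b).eval x * t ^ b := by
      intro x t
      conv_lhs => rw [hdecomp]
      rw [map_sum]
      refine Finset.sum_congr rfl fun b _ => ?_
      rw [eval_cons_smul_of_isWeightedHomogeneous _ b
        (MvPolynomial.weightedHomogeneousComponent_isWeightedHomogeneous b E) x qh t, hPdef, eval_fibre]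
      ring
    -- signs of the top fibre polynomial at the shells
    have hsign : ∀ j : Fin k, 0 ≤ c * (-1) ^ (j : ℕ) * (P bs).eval (-(μ j)) := by
      intro j
      refine top_coeff_nonneg bs (fun b => c * (-1) ^ (j : ℕ) * (P b).eval (-(μ j))) fun t ht => ?_
      have htne : t ≠ 0 := by
        intro h0
        rw [h0] at ht
        linarith
      have hq : t • qh ≠ 0 := smul_ne_zero htne hqh
      have h := hALT (t • qh) hq j
      rw [hscale, Finset.mul_sum] at h
      simpa only [mul_assoc] using h
    -- `X`-degree bound from the budget: `deg P(bs) ≤ k − 2`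
    have hcoeff : ∀ n : ℕ, k ≤ n + 1 → (P bs).coeff n = 0 := by
      intro n hn
      rw [hPdef, Polynomial.coeff_map]
      have hzero' : (MvPolynomial.finSuccEquiv ℝ 3 (MvPolynomial.weightedHomogeneousComponent w bs E)).coeff n = 0 := by
        refine MvPolynomial.ext _ _ fun m => ?_
        rw [MvPolynomial.finSuccEquiv_coeff_coeff, MvPolynomial.coeff_zero]
        by_contra hne'
        have hmem : (m.cons n) ∈ (MvPolynomial.weightedHomogeneousComponent w bs E).support :=
          MvPolynomial.mem_support_iff.2 hne'
        rw [MvPolynomial.support_weightedHomogeneousComponent, Finset.mem_filter] at hmem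
        have hb := hbudget _ hmem.1
        have hwt := hmem.2
        rw [hwdef, weight_q] at hwt
        simp only [Finsupp.cons_zero, Finsupp.cons_succ] at hb hwt
        omega
      rw [hzero', map_zero]
    -- Lagrange alternation over the nodes `−μ_{k−1} < ⋯ < −μ₀`
    have hP0 : P bs = 0 := by
      refine lagrangeAlternation k (P bs) (fun i => -(μ (Fin.rev i))) ?_ hcoeff ?_
      · intro i i' hii'
        simp only [neg_lt_neg_iff]
        exact hμ (Fin.rev_lt_rev.2 hii')
      · have hrev : ∀ i : Fin k,
            c * (-1) ^ ((Fin.rev i : Fin k) : ℕ) = (c * (-1) ^ (k - 1)) * (-1) ^ (i : ℕ) := by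
          intro i
          have hi : (i : ℕ) + 1 ≤ k := i.2
          rw [Fin.val_rev, mul_assoc, ← pow_add]
          congr 1
          rw [show k - 1 + (i : ℕ) = (k - ((i : ℕ) + 1)) + 2 * (i : ℕ) by omega, pow_add, pow_mul]
          norm_num
        rcases lt_or_gt_of_ne (show c * (-1 : ℝ) ^ (k - 1) ≠ 0 from
            mul_ne_zero hc (pow_ne_zero _ (by norm_num))) with hneg | hpos
        · right
          intro i
          have h := hsign (Fin.rev i)
          rw [hrev i, mul_assoc] at h
          exact nonpos_of_mul_nonneg_right h hneg
        · left
          intro i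
          have h := hsign (Fin.rev i)
          rw [hrev i, mul_assoc] at h
          exact nonneg_of_mul_nonneg_right h hpos
    exact hP0
  -- hence the top component vanishes identically
  apply hbs.2
  apply MvPolynomial.funext
  intro y
  rw [map_zero, ← Fin.cons_self_tail y]
  by_cases hq : Fin.tail y = 0
  · have h := eval_cons_smul_of_isWeightedHomogeneous _ bs
      (MvPolynomial.weightedHomogeneousComponent_isWeightedHomogeneous bs E) (y 0) (fun _ => (1 : ℝ)) 0
    rw [zero_smul, zero_pow (by omega), zero_mul] at h
    rw [hq]
    exact h
  · rw [← eval_fibre, hfib0 (Fin.tail y) hq, Polynomial.eval_zero]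

end Summit.QuantumFields.YangMills.Theorems.RationalShortRootRigidity.Alternation
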